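import Literature.IUT.HodgeArakelov.LabelClassesOfCuspsCor24iiYddOfCoverModel
import Literature.AnabelianGeometry.EtaleTheta.ThetaSettingOriginClauses
import Literature.AnabelianGeometry.EtaleTheta.SettingBridge
import HarnessLib

/-!
# [IUTchII] Cor 2.4 (ii) (a), sub-node (a.2) at the genuine `±`-tower: the cusp-splitting input DERIVED from the
# REGISTERED [EtTh] §1 origin clauses (R2 `GtpYNFromCusp` of `IsThm16Origin` + (P3) of `OncePuncturedData`)

S. Mochizuki, *Inter-universal Teichmüller Theory II*, kurims (Dec. 2020) §2 Cor. 2.4 (ii)(a) p. 70; Mochizuki, *The étale theta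
function …* [EtTh], §1 PRIMS p. 13 («… this image determines a Galois covering `Y_N → Y` such that the resulting surjection
`Π^tp_Y ↠ Gal(Y_N/Y)`, whose kernel we denote by `Π^tp_{Y_N}` …»). [cite: Mochizuki2012, II Cor 2.4 (ii) p.70]
[cite: MochizukiEtTh2009, §1 p.13]

PROOF-ONLY (abc-iut cell, seat abc-iut-w6-d069; node `IUTchII:Cor2.4(ii)`, GAP-LEDGER G-w6d069-1).  The clause requested in
G-w6d069-1 — «`D_x ∩ aug⁻¹(G_{K_N}) ⊆ Π^tp_{Y_N}` for every cusp `x` and every `N`» — is NOT a new origin clause: it FOLLOWS from two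
inputs ALREADY REGISTERED in abc-iut-L2's [EtTh] §1 vocabulary:
* R2 = abc-iut-L6-d5's `Thm16Sub.GtpYNFromCusp D N` (FACT-LIST F-3213; the field `gtpYN_fromCusp` of the origin predicate
  `ThetaSetting.IsThm16Origin`, `ThetaSettingOriginClauses.lean`): «for every cuspidal decomposition group `Dc ⊆ Π^tp_Y`,
  `Π^tp_{Y_N}` is the set of `g ∈ Π^tp_Y` with `aug g ∈ G_{K_N}` whose ell-image lies in `(Dc ∩ aug⁻¹G_{K_N})^ell · N·(Δ^tp_Y)^ell`» —
  its (←) direction at `Dc := D_x`;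
* (P3) = the PARAMETER `ThetaSetting.OncePuncturedData.decomp_le_ker_toZ` of `SettingBridge.lean` («decomposition groups of cusps
  lie in `Π^tp_Y`»).
Hence (`cuspDecomp_one_le_map_YddL_ofCoverModel_of_origin`) the binder `hYdd` of every landed closer of the node holds AT THE GENUINE
TOWER `PlusMinusTower.ofCoverModel` given, BY NAME, {F-1704, F-1708 instance forms at `X`; `IsThm16Origin` (R2); `OncePuncturedData`
(P3)} — all registered named inputs; G-w6d069-1 needs no new clause.  Nothing of the series / of [EtTh] is asserted; no side taken on
[IUTchIII] Cor. 3.12; typed ≠ proved.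
-/

noncomputable section

namespace Literature.AnabelianGeometry.EtaleTheta

namespace ThetaSetting

open Literature.AnabelianGeometry.SemiGraphs
open scoped Pointwise

variable {p : ℕ} [Fact p.Prime] (D : ThetaSetting p)

/-- **The cusp-splitting clause of G-w6d069-1 from R2 + (P3).**  If `Π^tp_{Y_N}` is cut out by the cusp section (R2 =
`Thm16Sub.GtpYNFromCusp D N`, [EtTh] p. 13) and the decomposition groups of the cusps lie in `Π^tp_Y` ((P3)), then
`D_x ∩ aug⁻¹(G_{K_N}) ⊆ Π^tp_{Y_N}` for every cusp `x`: the (←) direction of R2 at `Dc := D_x`, the ell-image condition being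
witnessed by `g` itself.  PROVED. [cite: MochizukiEtTh2009, §1 p.13] -/
theorem decomp_inf_le_GtpYN_of_gtpYNFromCusp (N : ℕ+) (hR2 : Thm16Sub.GtpYNFromCusp D N)
    (hP3 : ∀ x : D.Pt, D.IsCusp x → D.decomp x ≤ D.GtpY) :
    ∀ x : D.Pt, D.IsCusp x → D.decomp x ⊓ (D.GKN N).comap D.aug.toMonoidHom ≤ D.GtpYN N := by
  intro x hx g hg
  have hcusp : D.IsCuspidalDecompositionGroup (D.decomp x) := ⟨x, hx, 1, (one_smul _ _).symm⟩
  refine (hR2 (D.decomp x) hcusp (hP3 x hx) g).mpr ⟨hP3 x hx hg.1, ?_, ?_⟩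
  · exact Subgroup.mem_comap.mp hg.2
  · exact Subgroup.mem_sup_left ⟨g, hg, rfl⟩

/-- **The clause of G-w6d069-1 for every `N`, from the REGISTERED inputs `IsThm16Origin` (its field R2) and
`OncePuncturedData` (its parameter (P3)).**  PROVED. [cite: MochizukiEtTh2009, §1 p.13] -/
theorem decomp_inf_le_GtpYN_of_origin (hO : D.IsThm16Origin) (e : D.OncePuncturedData) :
    ∀ x : D.Pt, D.IsCusp x → ∀ N : ℕ+, D.decomp x ⊓ (D.GKN N).comap D.aug.toMonoidHom ≤ D.GtpYN N :=
  fun x hx N => D.decomp_inf_le_GtpYN_of_gtpYNFromCusp N (hO.gtpYN_fromCusp N) e.decomp_le_ker_toZ x hx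

end ThetaSetting

end Literature.AnabelianGeometry.EtaleTheta

namespace Literature.IUT.HodgeArakelov

open Literature.AnabelianGeometry.EtaleTheta Literature.AnabelianGeometry.SemiGraphs
open scoped Pointwise

namespace PlusMinusTower

variable {p : ℕ} [Fact p.Prime] {M : MuTwoSetting p} (e : M.CLevelData)
  {E : M.toThetaSetting.EtaleThetaData} {l : ℕ} (C : E.DoubleUnderline l) {N : ℕ+}
  (μ : M.toThetaSetting.CyclotomeMod l N) (hC : M.toThetaSetting.Compat) (hS : M.toThetaSetting.Sec2Hyps)
  (hl : l.Prime) (hp2 : p ≠ 2) (hpl : p ≠ l) (hζ : ∃ ζ : M.toThetaSetting.K, IsPrimitiveRoot ζ (4 * l))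
  {η : (C.thetaEnvData μ hC hS).PiYdd → MuN p N} (hη : η ∈ (C.thetaEnvData μ hC hS).thetaCocycles)
  {Q : Type} [Group Q] [TopologicalSpace Q] [IsTopologicalGroup Q]
  (ι : M.GtpC →ₜ* Q) (hι : IsProfiniteCompletion ι) (hinj : Function.Injective ι)
  (Φ : Q →* GQp p) (hΦ : ∀ g : M.GtpC, Φ (ι g) = e.augC g) (hΦK : Φ.range = M.GK)
  (hZ : Thm16Sub.KerToZIsCompactlyGenerated M.toThetaSetting) (hN : (C.Huu.subgroupOf (M.GtpXu l)).Normal)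
  {P : TopGroup.{0}} (T : TemperedCoverings (BadPlaceSetting.ofUnderline C μ hC hS hl hp2 hpl hζ hη) P)

/-- **IUTchII:Cor2.4(ii)** (a), sub-node (a.2) «`D_t ⊆ Π^tp_{Ÿ̲_v}`» AT THE GENUINE `±`-TOWER, every input a REGISTERED name
(kurims p. 70 l. 34–42; [EtTh] §1 p. 13): for the cuspidal-inertia datum `Cu` of the B13-GENUINE characterisation on
`W := ofCoverModel …`, the binder `hYdd` of the node's closers holds, given BY NAME: [SemiAnbd] Thm. 6.5 (iii)/(ii) instance forms at
`X` (F-1704 / F-1708), the [EtTh] §1 ORIGIN PREDICATE `IsThm16Origin` of the setting (R2 `GtpYNFromCusp`, F-3213) and its bridge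
PARAMETERS `OncePuncturedData` ((P3) `decomp_le_ker_toZ`).  PROVED (`cuspDecomp_one_le_map_YddL_ofCoverModel_of_cuspSection` ∘
`ThetaSetting.decomp_inf_le_GtpYN_of_origin`).  GAP-LEDGER G-w6d069-1 needs NO new clause. [claim: Mochizuki2012, status: disputed] -/
theorem cuspDecomp_one_le_map_YddL_ofCoverModel_of_origin
    (Cu : CuspidalInertiaData (ofCoverModel e C μ hC hS hl hp2 hpl hζ hη ι hι hinj Φ hΦ hΦK hZ hN T))
    (hchar : ∀ Q' J : Subgroup (ofCoverModel e C μ hC hS hl hp2 hpl hζ hη ι hι hinj Φ hΦ hΦK hZ hN T).Corhat,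
      Cu.IsCuspidalInertia Q' J ↔ J ≤ Q' ∧ ∃ i : {x : M.Pt // M.IsCusp x} × M.GtpC,
        ∃ t ∈ (ofCoverModel e C μ hC hS hl hp2 hpl hζ hη ι hι hinj Φ hΦ hΦK hZ hN T).piPM,
          J = MulAut.conj t •
            (((MulAut.conj i.2 • (M.toTemperedCurve.inertia i.1.1).map M.inclX) ⊓ (M.GtpXu l).map M.inclX).map
              ι.toMonoidHom :
              Subgroup (ofCoverModel e C μ hC hS hl hp2 hpl hζ hη ι hι hinj Φ hΦ hΦK hZ hN T).Corhat))
    (habs : M.toTemperedCurve.IsoPreservesCuspidalDecomp M.toTemperedCurve)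
    (hcomm : M.toTemperedCurve.DecompEqCommensuratorOfOpenInertia)
    (hO : M.toThetaSetting.IsThm16Origin) (eO : M.toThetaSetting.OncePuncturedData) (H : Subgroup P) :
    ∀ I : Subgroup (ofCoverModel e C μ hC hS hl hp2 hpl hζ hη ι hι hinj Φ hΦ hΦK hZ hN T).Corhat,
      Cu.IsCuspidalInertia (ofCoverModel e C μ hC hS hl hp2 hpl hζ hη ι hι hinj Φ hΦ hΦK hZ hN T).piV I →
        I ≤ (ofCoverModel e C μ hC hS hl hp2 hpl hζ hη ι hι hinj Φ hΦ hΦK hZ hN T).deltaBox H →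
          (ofCoverModel e C μ hC hS hl hp2 hpl hζ hη ι hι hinj Φ hΦ hΦK hZ hN T).cuspDecomp I 1 ≤
            (T.YddL).map ((ofCoverModel e C μ hC hS hl hp2 hpl hζ hη ι hι hinj Φ hΦ hΦK hZ hN T).emb.comp T.incl) :=
  cuspDecomp_one_le_map_YddL_ofCoverModel_of_cuspSection e C μ hC hS hl hp2 hpl hζ hη ι hι hinj Φ hΦ hΦK hZ hN T Cu hchar
    habs hcomm (ThetaSetting.decomp_inf_le_GtpYN_of_origin M.toThetaSetting hO eO) H

end PlusMinusTower

end Literature.IUT.HodgeArakelov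

end
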